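import Literature.MathematicalPhysics.QuantumFieldTheory.Balaban1983to89.B16Improved189FullBudget
import Literature.MathematicalPhysics.QuantumFieldTheory.Balaban1983to89.TreeLengthTorus

/-!
# `Balaban1983to89.B16Improved189ArbitraryRegion` — [Balaban1989LargeFieldII] p. 387 ll. 25–29: the improved bound
(1.89) «for the 𝐓-operation connected with an ARBITRARY large field region» (horizon `K ≥ 1`) — the located geometric
comparison `hgeo` of `B16Improved189.improved189_of_budget_general` DISCHARGED in the cell's ℤᵈ index model, and the
merger terminal binder `htsub` of `B16Improved189FullBudget` discharged from condition (i) at the terminal scales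

T. Bałaban, *Large field renormalization. II. Localization, exponentiation, and bounds for the 𝐑 operation*, Commun.
Math. Phys. **122** (1989) 355–392, doi:10.1007/bf01238433 [Balaban1989LargeFieldII] (cell paper B16 = [V]; PDF held
`paper:balaban1989-cmp122-large-field-ii`, journal page = PDF page + 354; p. 384 = PDF 30, p. 387 = PDF 33).  [IV] = T.
Bałaban, *Large field renormalization. I. The basic step of the 𝐑 operation*, Commun. Math. Phys. **122** (1989) 175–202
[Balaban1989LargeFieldI] p. 177 (conditions (i), (ii)).  [III] = T. Bałaban, *Convergent renormalization expansions for
lattice gauge theories*, Commun. Math. Phys. **119** (1988) 243–285 [Balaban1988Convergent] ((2.9) p. 256, Cor. 3 (2.50)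
p. 264).  [I] = [Balaban1987RG1] p. 257 (the linear size `d_j(X)`: length, in `M`-cube units, of a shortest tree graph
meeting all `M`-cubes of `X`).

statement-level bookkeeping of a published proof with citation tags; proofs kernel-checked; nothing here is a claim
about the Yang–Mills mass gap.  Seat `pub-ymgap-dag-n13-d` (R134 acceleration seat (a), strategy s1′), YM-DAG node N13
[B16] Cor. 3 pp. 387∕391, `--supports stmt-QuantumFields-19674` (K1 `StabilityBAtRecordR11e`).

CITATION HEADER (lean-in-tree rule 2026-08-18) ∕ WHAT IS PRINTED.  p. 387 [PDF 33] ll. 21–29, verbatim: *"Let us draw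
some conclusions from the statement. At first, the domain X in the definition (1.71) satisfies the assumption of the
statement with K = 0, therefore κ_k(X) ≧ 0, and we have the fundamental inequality 𝐓′_k(X)1 ≦ exp(−2(1+β₀)⁻¹p₀(g_k)).
(1.89) Next, we have noticed already that the inequality (1.79) holds for the 𝐓-operation connected with an arbitrary
large field region. The inequality (1.80) holds quite generally for such regions, hence also an improved bound (1.89),
with the additional term −κ₁d_k(X) in the exponential. This implies the inequality (2.50) [III], hence Corollary 3."*
p. 384 [PDF 30]: *"If Z is a component of Z_j, and j(Z) is the index of a first large field region contained in Z, then
we write the factor connected with Z in the form exp(−κ_j(Z) − 2p₀(g_{j(Z)})). … If Z is a union of MR_j-cubes of the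
lattice T_ξ, ξ = L^{−j}, then we take the cover Z′ of Z by a smallest union of LMR_{j+1}-cubes, and we add ten layers of
such cubes. We denote the obtained domain by S(Z), i.e., S(Z) = Z′^{~10}. … κ_j(Z) ≧ Σ_{n=j+1}^{j+K}
O(1)M^dR_n^{d+1}d′_n(S^{n−j}(Z)). (1.80)"*; same page: *"the number K is the smallest positive integer having the
property that the domain S^K(Z) … satisfies the conditions (i), (ii)"*; [IV] p. 177: *"(i) it is contained in a cube of
the size 100 MR_k"*; [III] (2.9) p. 256: *"R_n ≦ L R_m"* (n > m).

THE LOCATED BINDER THIS FILE DISCHARGES.  The Cor.-3 chain of the tree (`B14Cor3 → B16Cor3 → B16Cor3Scales → B16Cor3Ops →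
B16Cor3Wilson → B16Cor3CurlyGas → B16NodeKnitRecord9Cor3`) consumes, per large-field component `X` of the step-`k`
representation (1.72), the weight `hw : 𝐓_X[B_X] ≤ exp(−c₀ − κ₁d_k(X))` (`B16Cor3Wilson.uvIneq_of_repr172_wilson`); the
decay `e^{−κ₁d_k(X)}` is the entropy factor of the (2.50) upper bound (`B16Cor3.lfFamilySum_le_exp`,
`TreeLengthTorus.hTree_torus`).  Today `hw` is supplied only by `B16Cor3Wilson.hw_of_improved189` ⇐
`B16Improved189.improved189_of_fundIneq`, whose trade `htrade : κ₁d_k(X) ≤ (1+β₀)⁻¹p₀(g_k)` is inhabitable for the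
domains of (1.71) (horizon `K = 0`, condition (i) at scale `k`: `B16Improved189FullBudget.hgeo_of_condI`, `d_k(X) ≤
(100R_k)^d`) but NOT for the components of the new region `Z_k` — horizon `K ≥ 1`, linear size unbounded —, which is
precisely print's «(1.80) holds quite generally for such regions, hence also an improved bound (1.89)».  The tree's
`K ≥ 1` route, `B16Improved189.improved189_of_budget_general` (cell GAPS G-adv3-6 (2)(b)), pays `κ₁d_k(X)` from the
`n = k+1` term `O(1)M^dR_{k+1}^{d+1}d′_{k+1}(S(X))` of (1.80) GIVEN the comparison

  `hgeo`   `d_k(X) ≤ c·(L·R_{k+1})^d·(d′_{k+1}(S(X)) + 1)`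

(«X ⊂ S(X), a union of MR_{k+1}-cubes each holding (LR_{k+1})^d M-cubes of scale k — reader-level geometry, a HYPOTHESIS
here», its docstring), which NO tree file discharges.  §2 proves it, with `c = 4·2^d`, in the index model the cell uses
for every other geometric binder of pp. 384–387 (`B16SProfile`, `B16StoppingRule`, `B16MergeGeometry`,
`B16Lem384Induction` §8–§10, `B16Improved189FullBudget` §7): the MR_k-cubes of scale `k` are indexed by `ℤᵈ`
(`B13ScaleTransfer.Pt`), a region `X` is its index set `X₀` (non-empty, face-connected), its `M`-cubes are
`fineCubes R_k X₀` (`B13Factor210Literal.fineCubes`, `R_k` M-cubes per MR_k-cube side), `d_k(X) = treeLen (fineCubes R_k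
X₀)` (`TreeLength.treeLen`, [I] p. 257), the next partition is `q_k = LMR_{k+1}∕MR_k` times coarser, `S(X) = Sop q_k X₀ =
collar^[10] (closureIdx q_k X₀)` (`B16SProfile.Sop`) and `d′_{k+1}(S(X)) = treeLen (Sop q_k X₀)` (in MR_{k+1}-cube units);
the two-lattice dictionary is `R_k·q_k = L·R_{k+1}`.

WHAT THIS FILE PROVES (kernel-checked, zero `sorry`, theorems only — no `def`∕`structure`; axioms standard; BY NAME:
`TreeLength.{treeLen_le_card_sub_one, card_le_treeLen, treeLen_nonneg}`, `B16Ineq197ClassOne.{mem_fineCubes_coarse,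
card_fineCubes, subset_fineCubes_closureIdx, fineCubes_mono, fineCubes_nonempty_iff, faceConnected_fineCubes}`,
`B16SProfile.{Sop, coarse_coarse, subset_iterate_collar, faceConnected_Sop, Sop_nonempty}`,
`B16Improved189.improved189_of_budget_general`, `B16Improved189FullBudget.terminal_treeLen_le_of_condI`,
`TreeLengthTorus.torusTreeLen_image_le_treeLen`, `Step.Budget.{Consts.cost, Controls}` — nothing re-proved):
§1 TWO NESTED PARTITIONS COMPOSE: `fineCubes_fineCubes` (`fineCubes R (fineCubes q S) = fineCubes (R·q) S`),
   `closureIdx_subset_Sop`, `subset_fineCubes_Sop` (`X₀ ⊆` the q-cubes of `S(X)`), `fineCubes_subset_fineCubes_of_cover`,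
   `fineCubes_subset_fineCubes_Sop` (the M-cubes of `X` lie among the `(R·q)^d·#S(X)` M-cubes of `S(X)` — print's «X ⊂ S(X)»).
§2 THE COMPARISON: `card_fineCubes_le_of_cover`, `treeLen_fineCubes_le_of_cover` (for ANY face-connected family `Y` of
   q-times-coarser cubes covering `X`: `d_k(X) ≤ 4·2^d·(Rq)^d·(treeLen Y + 1) − 1`, from a spanning tree of the M-cubes,
   `treeLen ≤ # − 1`, the cube count `# = (Rq)^d·#Y` and the REPAIRED lower (2.30) [II] `#Y ≤ 2^d(4·treeLen Y + 1)`),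
   **`treeLen_fineCubes_le_Sop`** (`Y := S(X)`), **`hgeo_of_Sop`** (the binder `hgeo` verbatim, `c = 4·2^d`, through the
   dictionary `R·q = L·R_{k+1}`).
§3 THE `n = k+1` TERM OF (1.80): `cost_nonneg`, `cost_succ_le_of_controls` (`Controls b k K κ s`, `K ≥ 1`, non-negative
   constants and sizes ⇒ `cost_{k+1}(s_{k+1}) ≤ κ` — the binder `hcost`).
§4 **`improved189_arbitrary_ofIndex`** — THE SENTENCE p. 387 ll. 25–29 FOR A COMPONENT WITH `K ≥ 1`: from the factor form
   `𝐓 ≤ exp(−κ_k(X) − P)` of p. 384 (`P = 2p₀(g_{j(X)})`), (1.80) at scale `k` with horizon `K ≥ 1` and profile entry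
   `s_{k+1} = d′_{k+1}(S(X))`, `2ap ≤ P` (half of the `p₀`-factor, `a = (1+β₀)⁻¹`, `p = p₀(g_k)`, [III] §2 monotonicity of
   `p₀(g_j)`), and the two located constant clauses of `improved189_of_budget_general` (`hslope`, `hdef`) — NO geometric
   hypothesis: `𝐓 ≤ exp(−ap − κ₁·d_k(X))` with `d_k(X) = treeLen (fineCubes R X₀)`; i.e. the `hw`-currency of
   `B16Cor3Wilson` with `c₀ = (1+β₀)⁻¹p₀(g_k)` for the components of `Z_k`, the same exponent the `K = 0` supply
   `hw_of_improved189` delivers for the domains of (1.71).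
§5 THE LOCATED CLAUSES MADE EXPLICIT (print: «for p₀ large and γ small enough», no constant named): `slope_of_small_kappa`
   (`hslope` from `κ₁·c·L^d ≤ O(1)M^d` and `R_{k+1} ≥ 1`) and `deficit_trade_of_exponents` (`hdef`: `κ₁c(LR_{k+1})^d ≤
   (1+β₀)⁻¹A₀x^{p₀}` from `R_{k+1} ≤ LR_k` ((2.9) first member), `R_k ≤ Lx^{r₀}` (`B16Improved189.Rj_le_L_mul_pow`),
   `p₀ ≥ d·r₀ + 1` (ledger R9 is stronger) and `x = log g_k⁻² ≥ max(1, (1+β₀)κ₁cL^{3d}∕A₀)` — the sibling of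
   `B16Improved189.size_trade_of_exponents`).
§6 THE TORUS READING (the Cor.-3 chain's carrier `TreeLengthTorus.tsys d N`, `dj = torusTreeLen`): `torus_dj_le_treeLen_of_lift`
   (a torus component that is the projection of a face-connected ℤᵈ family is not longer than it — projection never
   lengthens), **`improved189_arbitrary_torus`** (§4 with `(tsys d N).dj X` in the exponent for a component `X` whose cube
   family is the projection of `fineCubes R X₀`).
§7 THE FULL-BUDGET ROUTE: `terminal_le_const_of_condI` and **`htsub_of_condI`** ∕ `htsub_binder_of_condI` — the merger
   terminal sub-additivity `htsub : t(T) ≤ t({x}) + t(T∖{x}) + E_t` of `B16Improved189FullBudget.mergeT_rhs_le` ∕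
   `mergeT_controls` (there: «stays reader-level geometry») holds OUTRIGHT with `E_t := κ₁((Nsz·R_max)^d − 1)` once every
   terminal term is `κ₁·d(S^K(∪T))` for a terminal index set satisfying condition (i) (the DEFINITION of the horizon, p. 384)
   on a lattice of ratio `R ≤ R_max` (`R_n ≤ LR_{j+1}` on the control range, (2.9): `R_max = L·R_{j+1}`) — by
   `terminal_treeLen_le_of_condI` and `t ≥ 0`; so both geometric binders of the full-budget file (`ht`: its §7; `htsub`:
   here) reduce to condition (i) plus located clauses of the `(const·R)^d ≤ budget` type.
§8 `improved189_arbitrary_of_invariant` — §4 read from (1.80) FOR EVERY COMPONENT at scale `k`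
   (`Step.Budget.ScaleData.Invariant`, the conclusion of `B16Lem384Induction.invariant_all_ofIndex`), for a component of
   horizon `K ≥ 1`.
§9 (v1.1, append-only) `profile_entry_succ`, `dictionary_of_exponents`, **`improved189_arbitrary_ofIndexProfile`** — §4 with
   `hsize` and `hRq` DERIVED from the index-model profile `s = fun n => treeLen (Siter (ratio L σ) (n − k) X₀)` of
   `B16Lem384Induction` §8–§9 and the flow's exponents `R_k = L^{σ₀}`, `R_{k+1} = L^{σ₁}`, `σ₀ ≤ σ₁ + 1` ((2.5), (2.9) [III]).
HONEST SCOPE.  (a) Index model, as in every sibling: regions are finite families of cube indices in `ℤᵈ` (resp. their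
projections to the torus in §6), `d_k`∕`d′_{k+1}` are `treeLen` of the M-cube ∕ MR_{k+1}-cube index families, `S` is
`B16SProfile.Sop`; that the actual lattices `T_{L^{−n}}` carry nested cube partitions with integer ratio `q_k = LR_{k+1}∕R_k`
is the standing READING of `B16SProfile` ((2.5) makes the `R`'s powers of `L`).  (b) The constant `c = 4·2^d` (d = 4: 64)
replaces the «3^d(2d′+1)» of GAPS G-adv3-6 (2)(b); immaterial inside the located clauses.  (c) Which budget (full or
halved) (2.50) [III] needs cannot be read off [V] (GAPS G-adv3-2, G-B16-08 (c)); the chain closes with either.  (d) The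
factor form `𝐓 ≤ exp(−κ_k(X) − 2p₀(g_{j(X)}))` ((1.79) regrouped, p. 384) and (1.80) itself stay hypotheses (`hT`,
`hctl`) — they are the objects of `Step.Budget` ∕ `B16Lem384Induction`, not of this file; nothing of (1.79)–(1.89) is
asserted; one finite programme at fixed `ε`, Bałaban AS PRINTED; nothing continuum ∕ ℝ⁴ ∕ OS ∕ mass gap ∕ Clay.
-/

namespace Literature.MathematicalPhysics.QuantumFieldTheory.Balaban1983to89.B16Improved189ArbitraryRegion

open Literature.MathematicalPhysics.QuantumFieldTheory.Balaban1983to89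
open Literature.MathematicalPhysics.QuantumFieldTheory.Balaban1983to89.B13ScaleTransfer
open Literature.MathematicalPhysics.QuantumFieldTheory.Balaban1983to89.TreeLength
open Literature.MathematicalPhysics.QuantumFieldTheory.Balaban1983to89.B16SProfile
  (Sop coarse_coarse subset_iterate_collar faceConnected_Sop Sop_nonempty)
open Literature.MathematicalPhysics.QuantumFieldTheory.Balaban1983to89.B13Factor210Literal (fineCubes)
open Literature.MathematicalPhysics.QuantumFieldTheory.Balaban1983to89.B16Ineq197ClassOne
  (mem_fineCubes_coarse card_fineCubes subset_fineCubes_closureIdx fineCubes_mono fineCubes_nonempty_iff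
    faceConnected_fineCubes)
open Literature.MathematicalPhysics.QuantumFieldTheory.Balaban1983to89.B16StoppingRule (CondI)
open Literature.MathematicalPhysics.QuantumFieldTheory.Balaban1983to89.B16Improved189FullBudget
  (terminal_treeLen_le_of_condI)
open Literature.MathematicalPhysics.QuantumFieldTheory.Balaban1983to89.TreeLengthTorus
  (tsys tsys_dj proj torusTreeLen torusTreeLen_image_le_treeLen)

noncomputable section

variable {n : ℕ}

/-! ## §1. Two nested partitions compose: the M-cubes of `X` among the M-cubes of `S(X)` -/

/-- Nested partitions compose: the `R`-fine cubes of the `q`-fine cubes of an index family `S` are its `(R·q)`-fine cubes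
(the M-cubes of the MR_k-cubes of the LMR_{k+1}-cubes of `S` are the M-cubes of those LMR_{k+1}-cubes;
`coarse q ∘ coarse R = coarse (R·q)`, `B16SProfile.coarse_coarse`). [cite: Balaban1989LargeFieldII, p.384 (nested cube partitions, definition of S)] -/
theorem fineCubes_fineCubes {R q : ℕ} (hR : 0 < R) (hq : 0 < q) (S : Finset (Pt n)) :
    fineCubes R (fineCubes q S) = fineCubes (R * q) S := by
  ext x
  rw [mem_fineCubes_coarse hR, mem_fineCubes_coarse hq, mem_fineCubes_coarse (Nat.mul_pos hR hq), coarse_coarse]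

/-- The cover `Z′` of p. 384 lies in `S(Z) = Z′^{~10}`: `closureIdx q X₀ ⊆ Sop q X₀`. [cite: Balaban1989LargeFieldII, p.384 (definition of S)] -/
theorem closureIdx_subset_Sop (q : ℕ) (X₀ : Finset (Pt n)) : closureIdx q X₀ ⊆ Sop q X₀ :=
  subset_iterate_collar 10 (closureIdx q X₀)

/-- Every cube of `X` lies in one of the `q`-times-coarser cubes of a cover `Y ⊇ Z′` of `X`. [cite: Balaban1989LargeFieldII, p.384 (the cover Z′)] -/
theorem subset_fineCubes_of_cover {q : ℕ} (hq : 0 < q) {X₀ Y : Finset (Pt n)} (hY : closureIdx q X₀ ⊆ Y) :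
    X₀ ⊆ fineCubes q Y :=
  (subset_fineCubes_closureIdx hq X₀).trans (fineCubes_mono q hY)

/-- «X ⊂ S(X)» on the MR_k-lattice: every MR_k-cube of `X` lies in one of the LMR_{k+1}-cubes of `S(X)`. [cite: Balaban1989LargeFieldII, p.384 (definition of S)] -/
theorem subset_fineCubes_Sop {q : ℕ} (hq : 0 < q) (X₀ : Finset (Pt n)) : X₀ ⊆ fineCubes q (Sop q X₀) :=
  subset_fineCubes_of_cover hq (closureIdx_subset_Sop q X₀)

/-- The M-cubes of `X` (ratio `R` below the MR_k-lattice) lie among the M-cubes of the union of the cubes of a cover `Y`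
on the `q`-times-coarser lattice (ratio `R·q` below it). [cite: Balaban1989LargeFieldII, p.384 (the cover Z′, nested cube partitions)] -/
theorem fineCubes_subset_fineCubes_of_cover {R q : ℕ} (hR : 0 < R) (hq : 0 < q) {X₀ Y : Finset (Pt n)}
    (hY : closureIdx q X₀ ⊆ Y) : fineCubes R X₀ ⊆ fineCubes (R * q) Y := by
  rw [← fineCubes_fineCubes hR hq]
  exact fineCubes_mono R (subset_fineCubes_of_cover hq hY)

/-- «X ⊂ S(X)» on the M-lattice: the M-cubes of `X` lie among the `(R·q)^d·#S(X)` M-cubes of `S(X)` (`R·q = L·R_{k+1}`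
M-cubes per LMR_{k+1}-cube side). [cite: Balaban1989LargeFieldII, p.384 (definition of S), p.387 ll.25–29] -/
theorem fineCubes_subset_fineCubes_Sop {R q : ℕ} (hR : 0 < R) (hq : 0 < q) (X₀ : Finset (Pt n)) :
    fineCubes R X₀ ⊆ fineCubes (R * q) (Sop q X₀) :=
  fineCubes_subset_fineCubes_of_cover hR hq (closureIdx_subset_Sop q X₀)

/-! ## §2. The comparison `d_k(X) ≤ c·(L·R_{k+1})^d·(d′_{k+1}(S(X)) + 1)` -/

/-- THE CUBE COUNT: `X` has at most `(R·q)^d·#Y` M-cubes for every cover `Y ⊇ Z′` by `q`-times-coarser cubes. [cite: Balaban1989LargeFieldII, p.384 (cube counts (MR_n)^{−d}|Z^{(n−j)}|)] -/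
theorem card_fineCubes_le_of_cover {R q : ℕ} (hR : 0 < R) (hq : 0 < q) {X₀ Y : Finset (Pt n)}
    (hY : closureIdx q X₀ ⊆ Y) : (fineCubes R X₀).card ≤ (R * q) ^ n * Y.card := by
  rw [← card_fineCubes (Nat.mul_pos hR hq)]
  exact Finset.card_le_card (fineCubes_subset_fineCubes_of_cover hR hq hY)

/-- THE COMPARISON AGAINST ANY FACE-CONNECTED COVER: for a non-empty face-connected family `X₀` of MR_k-cubes and a
face-connected family `Y ⊇ Z′` of `q`-times-coarser cubes, `d_k(X) ≤ 4·2^d·(R·q)^d·(treeLen Y + 1) − 1` — a spanning tree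
of the face-connected M-cubes of `X` (`treeLen ≤ # − 1`), the cube count, and the repaired lower (2.30) [II]
`#Y ≤ 2^d(4·treeLen Y + 1)` (`TreeLength.card_le_treeLen`). [cite: Balaban1989LargeFieldII, p.387 ll.25–29; Balaban1987RG1, p.257 (linear size d_j)] -/
theorem treeLen_fineCubes_le_of_cover {R q : ℕ} (hR : 0 < R) (hq : 0 < q) {X₀ Y : Finset (Pt n)} (hX : X₀.Nonempty)
    (hXc : FaceConnected X₀) (hY : closureIdx q X₀ ⊆ Y) (hYc : FaceConnected Y) :
    treeLen (fineCubes R X₀) ≤ 4 * 2 ^ n * ((R * q : ℕ) : ℝ) ^ n * (treeLen Y + 1) - 1 := by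
  have hYne : Y.Nonempty := (closureIdx_nonempty hX).mono hY
  have h1 := treeLen_le_card_sub_one ((fineCubes_nonempty_iff hR).2 hX) (faceConnected_fineCubes hR hXc)
  have h2 : ((fineCubes R X₀).card : ℝ) ≤ ((R * q : ℕ) : ℝ) ^ n * Y.card := by
    exact_mod_cast card_fineCubes_le_of_cover hR hq hY
  have h3 := card_le_treeLen hYne hYc
  have hpow : (0 : ℝ) ≤ ((R * q : ℕ) : ℝ) ^ n := by positivity
  have h4 : ((R * q : ℕ) : ℝ) ^ n * (Y.card : ℝ) ≤ ((R * q : ℕ) : ℝ) ^ n * (2 ^ n * (4 * treeLen Y + 1)) :=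
    mul_le_mul_of_nonneg_left h3 hpow
  have h5 : (2 : ℝ) ^ n * (4 * treeLen Y + 1) ≤ 4 * 2 ^ n * (treeLen Y + 1) := by
    have h2n : (0 : ℝ) ≤ 2 ^ n := by positivity
    nlinarith [treeLen_nonneg Y]
  have h6 : ((R * q : ℕ) : ℝ) ^ n * (2 ^ n * (4 * treeLen Y + 1))
      ≤ ((R * q : ℕ) : ℝ) ^ n * (4 * 2 ^ n * (treeLen Y + 1)) := mul_le_mul_of_nonneg_left h5 hpow
  linarith

/-- **THE COMPARISON AGAINST `S(X)`** (print's choice of cover, p. 384): for a non-empty face-connected family `X₀` of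
MR_k-cubes, `d_k(X) ≤ 4·2^d·(R·q)^d·(d′_{k+1}(S(X)) + 1) − 1` with `d_k(X) = treeLen (fineCubes R X₀)` (M-cube units) and
`d′_{k+1}(S(X)) = treeLen (Sop q X₀)` (LMR_{k+1}-cube units). [cite: Balaban1989LargeFieldII, p.387 ll.25–29, p.384 (definition of S)] -/
theorem treeLen_fineCubes_le_Sop {R q : ℕ} (hR : 0 < R) (hq : 0 < q) {X₀ : Finset (Pt n)} (hX : X₀.Nonempty)
    (hXc : FaceConnected X₀) :
    treeLen (fineCubes R X₀) ≤ 4 * 2 ^ n * ((R * q : ℕ) : ℝ) ^ n * (treeLen (Sop q X₀) + 1) - 1 :=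
  treeLen_fineCubes_le_of_cover hR hq hX hXc (closureIdx_subset_Sop q X₀) (faceConnected_Sop hq hXc)

/-- **THE BINDER `hgeo` OF `B16Improved189.improved189_of_budget_general`, VERBATIM**, through the two-lattice dictionary
`R·q = B` (`B = L·R_{k+1}`, the number of M-cubes per LMR_{k+1}-cube side): `d_k(X) ≤ c·B^d·(d′_{k+1}(S(X)) + 1)` with
`c = 4·2^d`. [cite: Balaban1989LargeFieldII, p.387 ll.25–29] -/
theorem hgeo_of_Sop {R q : ℕ} (hR : 0 < R) (hq : 0 < q) {X₀ : Finset (Pt n)} (hX : X₀.Nonempty)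
    (hXc : FaceConnected X₀) {B : ℝ} (hB : ((R * q : ℕ) : ℝ) = B) :
    treeLen (fineCubes R X₀) ≤ 4 * 2 ^ n * B ^ n * (treeLen (Sop q X₀) + 1) := by
  have h := treeLen_fineCubes_le_Sop hR hq hX hXc
  rw [hB] at h
  linarith

/-! ## §3. The `n = k+1` term of (1.80) is within the budget -/

/-- The cost `O(1)M^dR_m^{d+1}·s` of (1.80) is non-negative for non-negative constants and size. [cite: Balaban1989LargeFieldII, (1.80) p.384] -/
theorem cost_nonneg (b : Step.Budget.Consts) (hC : 0 ≤ b.C) (hM : 0 ≤ b.M) {m : ℕ} (hR : 0 ≤ b.R m) {s : ℝ} (hs : 0 ≤ s) :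
    0 ≤ b.cost m s := by
  unfold Step.Budget.Consts.cost
  exact mul_nonneg (mul_nonneg (mul_nonneg hC (pow_nonneg hM _)) (pow_nonneg hR _)) hs

/-- **THE BINDER `hcost`**: (1.80) at scale `k` with horizon `K ≥ 1` — `Σ_{m=k+1}^{k+K} cost_m(s_m) ≤ κ_k(X)`
(`Step.Budget.Controls`) — bounds its first term: `cost_{k+1}(d′_{k+1}(S(X))) ≤ κ_k(X)`, all terms being non-negative.
[cite: Balaban1989LargeFieldII, (1.80) p.384] -/
theorem cost_succ_le_of_controls (b : Step.Budget.Consts) {k K : ℕ} (hK : 1 ≤ K) {κ : ℝ} {s : ℕ → ℝ}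
    (h : Step.Budget.Controls b k K κ s) (hC : 0 ≤ b.C) (hM : 0 ≤ b.M) (hR : ∀ m, 0 ≤ b.R m) (hs : ∀ m, 0 ≤ s m) :
    b.cost (k + 1) (s (k + 1)) ≤ κ := by
  unfold Step.Budget.Controls at h
  refine le_trans ?_ h
  refine Finset.single_le_sum (f := fun m => b.cost m (s m)) (fun m _ => cost_nonneg b hC hM (hR m) (hs m)) ?_
  simp only [Finset.mem_Ioc]
  omega

/-! ## §4. The sentence p. 387 ll. 25–29 for a component with horizon `K ≥ 1`, no geometric hypothesis -/

/-- **THE IMPROVED BOUND (1.89) FOR AN ARBITRARY LARGE-FIELD REGION** (p. 387: *"the inequality (1.79) holds for the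
𝐓-operation connected with an arbitrary large field region. The inequality (1.80) holds quite generally for such regions,
hence also an improved bound (1.89), with the additional term −κ₁d_k(X) in the exponential"*), horizon `K ≥ 1`, in the
index model: a non-empty face-connected family `X₀` of MR_k-cubes with M-cube family `fineCubes R X₀` (`R = R_k`), the
factor form `𝐓 ≤ exp(−κ − P)` of p. 384 (`hT`; `κ = κ_k(X)`, `P = 2p₀(g_{j(X)})`), (1.80) for `κ` with horizon `K ≥ 1`
and profile `s` whose entry `s_{k+1}` is `d′_{k+1}(S(X)) = treeLen (Sop q X₀)` (`hctl`, `hsize`), the dictionary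
`R·q = L·R_{k+1}` (`hRq`) and `b.d = d` (`hdim`), `2ap ≤ P` (`hP`), and the located constant clauses `hslope`, `hdef`
(§5) give `𝐓 ≤ exp(−ap − κ₁·d_k(X))` — `B16Improved189.improved189_of_budget_general` with `hgeo` DISCHARGED by
`hgeo_of_Sop` (`c = 4·2^d`) and `hcost` by `cost_succ_le_of_controls`. [cite: Balaban1989LargeFieldII, p.387 ll.25–29, (1.80) p.384] -/
theorem improved189_arbitrary_ofIndex {V : Type*} (T1X : V → ℝ) (b : Step.Budget.Consts) (k K : ℕ) (hK : 1 ≤ K)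
    (κ P a p κ₁ L : ℝ) (s : ℕ → ℝ) {R q : ℕ} (hR : 0 < R) (hq : 0 < q)
    {X₀ : Finset (Pt n)} (hX : X₀.Nonempty) (hXc : FaceConnected X₀)
    (hT : ∀ v, T1X v ≤ Real.exp (-κ - P))
    (hctl : Step.Budget.Controls b k K κ s) (hC : 0 ≤ b.C) (hM : 0 ≤ b.M) (hRm : ∀ m, 0 ≤ b.R m) (hs : ∀ m, 0 ≤ s m)
    (hsize : s (k + 1) = treeLen (Sop q X₀))
    (hdim : b.d = n) (hRq : ((R * q : ℕ) : ℝ) = L * b.R (k + 1))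
    (hκ₁ : 0 ≤ κ₁) (hL : 0 ≤ L)
    (hslope : κ₁ * (4 * 2 ^ n) * L ^ b.d ≤ b.C * b.M ^ b.d * b.R (k + 1))
    (hP : 2 * a * p ≤ P)
    (hdef : κ₁ * ((4 * 2 ^ n) * (L * b.R (k + 1)) ^ b.d) ≤ a * p) :
    ∀ v, T1X v ≤ Real.exp (-(a * p) - κ₁ * treeLen (fineCubes R X₀)) := by
  have hgeo : treeLen (fineCubes R X₀) ≤ (4 * 2 ^ n) * (L * b.R (k + 1)) ^ b.d * (s (k + 1) + 1) := by
    rw [hdim, hsize]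
    exact hgeo_of_Sop hR hq hX hXc hRq
  exact B16Improved189.improved189_of_budget_general T1X b k κ P a p κ₁ _ (s (k + 1)) (4 * 2 ^ n) L hT
    (cost_succ_le_of_controls b hK hctl hC hM hRm hs) hgeo hκ₁ hL (hRm _) (hs _) hslope hP hdef

/-! ## §5. The located constant clauses («for p₀ large and γ small enough») made explicit -/

/-- **THE SLOPE CLAUSE `hslope`**: `κ₁·c·L^d ≤ O(1)·M^d·R_{k+1}` follows from the smallness `κ₁·c·L^d ≤ O(1)·M^d` of `κ₁`
(a restriction fixing `κ₁` in terms of the `O(1)` of (1.79)∕(1.80), `M`, `L`, `d`) since `R_{k+1} ≥ 1`. [cite: Balaban1989LargeFieldII, p.387 ("for p₀ large and γ small enough")] -/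
theorem slope_of_small_kappa {κ₁ c C M L R' : ℝ} {d : ℕ} (hR1 : 1 ≤ R') (hCM : 0 ≤ C * M ^ d)
    (hκ : κ₁ * c * L ^ d ≤ C * M ^ d) : κ₁ * c * L ^ d ≤ C * M ^ d * R' :=
  calc κ₁ * c * L ^ d ≤ C * M ^ d := hκ
    _ = C * M ^ d * 1 := (mul_one _).symm
    _ ≤ C * M ^ d * R' := mul_le_mul_of_nonneg_left hR1 hCM

/-- **THE DEFICIT CLAUSE `hdef`** as an exponent relation: with `x = log g_k⁻²`, `p₀(g_k) = A₀x^{p₀}`, `R_k ≤ L·x^{r₀}`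
(minimality in (2.5) [III], `B16Improved189.Rj_le_L_mul_pow`) and `R_{k+1} ≤ L·R_k` ((2.9) [III], first member): if
`p₀ ≥ d·r₀ + 1` and `x ≥ max(1, (1+β₀)κ₁cL^{3d}∕A₀)` then `κ₁·c·(L·R_{k+1})^d ≤ (1+β₀)⁻¹p₀(g_k)` — the deficit
`κ₁c(LR_{k+1})^d` of the `K ≥ 1` route is paid by half the `p₀`-factor, a `g_k`-smallness condition of the kind p. 389
prints; sibling of `B16Improved189.size_trade_of_exponents`. [cite: Balaban1989LargeFieldII, p.387, p.389; Balaban1988Convergent, (2.5) p.255, (2.9) p.256] -/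
theorem deficit_trade_of_exponents (A₀ β₀ κ₁ c L x R R' : ℝ) (d r₀ p₀ : ℕ)
    (hA : 0 < A₀) (hβ : 0 ≤ β₀) (hκ : 0 ≤ κ₁) (hc : 0 ≤ c) (hL : 0 ≤ L) (hR0 : 0 ≤ R')
    (hx1 : 1 ≤ x) (hR : R ≤ L * x ^ r₀) (hR' : R' ≤ L * R) (hp : d * r₀ + 1 ≤ p₀)
    (hx : (1 + β₀) * κ₁ * c * L ^ (3 * d) / A₀ ≤ x) :
    κ₁ * (c * (L * R') ^ d) ≤ (1 + β₀)⁻¹ * (A₀ * x ^ p₀) := by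
  have hβpos : 0 < 1 + β₀ := by linarith
  have hx0 : 0 ≤ x := by linarith
  have hxr : 0 ≤ x ^ r₀ := by positivity
  -- `L R' ≤ L³ x^{r₀}`
  have h0 : L * R' ≤ L ^ 3 * x ^ r₀ := by
    have h01 : R' ≤ L * (L * x ^ r₀) := hR'.trans (mul_le_mul_of_nonneg_left hR hL)
    calc L * R' ≤ L * (L * (L * x ^ r₀)) := mul_le_mul_of_nonneg_left h01 hL
      _ = L ^ 3 * x ^ r₀ := by ring
  -- `(L R')^d ≤ L^{3d} x^{d r₀}`
  have h1 : (L * R') ^ d ≤ L ^ (3 * d) * x ^ (d * r₀) := by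
    calc (L * R') ^ d ≤ (L ^ 3 * x ^ r₀) ^ d := pow_le_pow_left₀ (mul_nonneg hL hR0) h0 d
      _ = L ^ (3 * d) * x ^ (d * r₀) := by rw [mul_pow, ← pow_mul, ← pow_mul, mul_comm r₀ d]
  -- `x·x^{d r₀} ≤ x^{p₀}`
  have h2 : x * x ^ (d * r₀) ≤ x ^ p₀ := by
    calc x * x ^ (d * r₀) = x ^ (d * r₀ + 1) := by ring
      _ ≤ x ^ p₀ := pow_le_pow_right₀ hx1 hp
  -- `(1+β₀) κ₁ c L^{3d} ≤ A₀ x`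
  have h3 : (1 + β₀) * κ₁ * c * L ^ (3 * d) ≤ A₀ * x := by
    rwa [div_le_iff₀ hA, mul_comm x A₀] at hx
  have hxd : 0 ≤ x ^ (d * r₀) := by positivity
  have key : (1 + β₀) * (κ₁ * (c * (L * R') ^ d)) ≤ A₀ * x ^ p₀ := by
    calc (1 + β₀) * (κ₁ * (c * (L * R') ^ d))
        ≤ (1 + β₀) * (κ₁ * (c * (L ^ (3 * d) * x ^ (d * r₀)))) := by
          apply mul_le_mul_of_nonneg_left _ hβpos.le
          exact mul_le_mul_of_nonneg_left (mul_le_mul_of_nonneg_left h1 hc) hκ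
      _ = ((1 + β₀) * κ₁ * c * L ^ (3 * d)) * x ^ (d * r₀) := by ring
      _ ≤ (A₀ * x) * x ^ (d * r₀) := mul_le_mul_of_nonneg_right h3 hxd
      _ = A₀ * (x * x ^ (d * r₀)) := by ring
      _ ≤ A₀ * x ^ p₀ := mul_le_mul_of_nonneg_left h2 hA.le
  rw [← div_eq_inv_mul, le_div_iff₀ hβpos]
  linarith

/-! ## §6. The torus reading: the Cor.-3 chain's carrier `tsys d N` -/

/-- A torus component that is the projection of a non-empty face-connected ℤᵈ family `A` has torus linear size at most
`treeLen A` (projection never lengthens: `TreeLengthTorus.torusTreeLen_image_le_treeLen`). [cite: Balaban1987RG1, p.257 (linear size d_j)] -/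
theorem torus_dj_le_treeLen_of_lift {N : ℕ} [NeZero N] (X : (tsys n N).Dom) {A : Finset (Pt n)} (hA : A.Nonempty)
    (hAc : FaceConnected A) (hlift : X.1 = A.image (proj N)) : (tsys n N).dj X ≤ treeLen A := by
  rw [tsys_dj, hlift]
  exact torusTreeLen_image_le_treeLen hA hAc

/-- **THE IMPROVED BOUND FOR AN ARBITRARY REGION, ON THE TORUS CATALOGUE** of the Cor.-3 chain (`B16Cor3Torus`,
`B16Cor3CurlyGas`, `B16NodeKnitRecord9Cor3`: weights `exp(−c₀ − κ₁·(tsys d N).dj X)`): §4 for a component `X` of the torus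
whose M-cube family is the projection of `fineCubes R X₀`; since `(tsys d N).dj X ≤ treeLen (fineCubes R X₀)` and
`κ₁ ≥ 0`, `𝐓 ≤ exp(−ap − κ₁·dj X)`. [cite: Balaban1989LargeFieldII, p.387 ll.25–29] -/
theorem improved189_arbitrary_torus {V : Type*} (T1X : V → ℝ) (b : Step.Budget.Consts) (k K : ℕ) (hK : 1 ≤ K)
    (κ P a p κ₁ L : ℝ) (s : ℕ → ℝ) {R q : ℕ} (hR : 0 < R) (hq : 0 < q)
    {X₀ : Finset (Pt n)} (hX : X₀.Nonempty) (hXc : FaceConnected X₀)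
    {N : ℕ} [NeZero N] (X : (tsys n N).Dom) (hlift : X.1 = (fineCubes R X₀).image (proj N))
    (hT : ∀ v, T1X v ≤ Real.exp (-κ - P))
    (hctl : Step.Budget.Controls b k K κ s) (hC : 0 ≤ b.C) (hM : 0 ≤ b.M) (hRm : ∀ m, 0 ≤ b.R m) (hs : ∀ m, 0 ≤ s m)
    (hsize : s (k + 1) = treeLen (Sop q X₀))
    (hdim : b.d = n) (hRq : ((R * q : ℕ) : ℝ) = L * b.R (k + 1))
    (hκ₁ : 0 ≤ κ₁) (hL : 0 ≤ L)
    (hslope : κ₁ * (4 * 2 ^ n) * L ^ b.d ≤ b.C * b.M ^ b.d * b.R (k + 1))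
    (hP : 2 * a * p ≤ P)
    (hdef : κ₁ * ((4 * 2 ^ n) * (L * b.R (k + 1)) ^ b.d) ≤ a * p) :
    ∀ v, T1X v ≤ Real.exp (-(a * p) - κ₁ * (tsys n N).dj X) := by
  intro v
  have h := improved189_arbitrary_ofIndex T1X b k K hK κ P a p κ₁ L s hR hq hX hXc hT hctl hC hM hRm hs hsize hdim
    hRq hκ₁ hL hslope hP hdef v
  have hdj : (tsys n N).dj X ≤ treeLen (fineCubes R X₀) :=
    torus_dj_le_treeLen_of_lift X ((fineCubes_nonempty_iff hR).2 hX) (faceConnected_fineCubes hR hXc) hlift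
  refine h.trans (Real.exp_le_exp.mpr ?_)
  nlinarith [mul_le_mul_of_nonneg_left hdj hκ₁]

/-! ## §7. The full-budget route: the merger terminal binder `htsub` from condition (i) at the terminal scales -/

/-- A terminal term under condition (i) is bounded by a constant: for a non-empty face-connected terminal index set `SK`
satisfying (i) with size `Nsz` on a lattice of ratio `R ≤ R_max`, `κ₁·d(S^K(Z)) ≤ κ₁((Nsz·R_max)^d − 1)`
(`B16Improved189FullBudget.terminal_treeLen_le_of_condI` and monotonicity in `R`). [cite: Balaban1989LargeFieldII, p.384 (definition of K); Balaban1989LargeFieldI, p.177 (condition (i))] -/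
theorem terminal_le_const_of_condI {R Rmax Nsz : ℕ} (hR : 0 < R) (hRmax : R ≤ Rmax) {SK : Finset (Pt n)}
    (hne : SK.Nonempty) (hfc : FaceConnected SK) (hI : CondI Nsz SK) {κ₁ : ℝ} (hκ₁ : 0 ≤ κ₁) :
    κ₁ * treeLen (fineCubes R SK) ≤ κ₁ * (((Nsz : ℝ) * Rmax) ^ n - 1) := by
  refine mul_le_mul_of_nonneg_left ((terminal_treeLen_le_of_condI hR hne hfc hI).trans ?_) hκ₁
  have h : ((Nsz : ℝ) * R) ^ n ≤ ((Nsz : ℝ) * Rmax) ^ n := by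
    apply pow_le_pow_left₀ (by positivity)
    exact mul_le_mul_of_nonneg_left (by exact_mod_cast hRmax) (Nat.cast_nonneg _)
  linarith

/-- **THE MERGER TERMINAL BINDER `htsub` DISCHARGED**: if every terminal term is `t(T) = κ₁·d(S^{K(T)}(∪T))` — the M-cube
tree length `treeLen (fineCubes (Rt T) (SK T))` of a non-empty face-connected terminal index set `SK T` satisfying
condition (i) (the DEFINITION of the horizon, p. 384) on a lattice of ratio `0 < Rt T ≤ R_max` (`R_n ≤ L·R_{j+1}` on the
control range, (2.9) [III]) — then `t(T) ≤ t({x}) + t(T∖{x}) + E_t` for ALL `T, x` with `E_t := κ₁((Nsz·R_max)^d − 1)`: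
`t(T) ≤ E_t` outright and the pieces' terms are `≥ 0`. [cite: Balaban1989LargeFieldII, (1.85)–(1.88) pp.386–387, p.384 (definition of K)] -/
theorem htsub_of_condI {ι : Type*} [DecidableEq ι] (t : Finset ι → ℝ) {κ₁ : ℝ} (hκ₁ : 0 ≤ κ₁) {Nsz Rmax : ℕ}
    (SK : Finset ι → Finset (Pt n)) (Rt : Finset ι → ℕ)
    (ht : ∀ T, t T = κ₁ * treeLen (fineCubes (Rt T) (SK T)))
    (hRt : ∀ T, 0 < Rt T ∧ Rt T ≤ Rmax) (hne : ∀ T, (SK T).Nonempty) (hfc : ∀ T, FaceConnected (SK T))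
    (hI : ∀ T, CondI Nsz (SK T)) (T : Finset ι) (x : ι) :
    t T ≤ t {x} + t (T.erase x) + κ₁ * (((Nsz : ℝ) * Rmax) ^ n - 1) := by
  have h0 : ∀ U, 0 ≤ t U := fun U => by
    rw [ht]
    exact mul_nonneg hκ₁ (treeLen_nonneg _)
  have h1 : t T ≤ κ₁ * (((Nsz : ℝ) * Rmax) ^ n - 1) := by
    rw [ht]
    exact terminal_le_const_of_condI (hRt T).1 (hRt T).2 (hne T) (hfc T) (hI T) hκ₁
  linarith [h0 {x}, h0 (T.erase x)]

/-- The same in the exact binder shape of `B16Improved189FullBudget.mergeT_rhs_le` ∕ `mergeT_controls` (subfamilies of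
the merging family `S`, connectedness premises — all unused: the bound is outright). [cite: Balaban1989LargeFieldII, (1.85)–(1.88) pp.386–387] -/
theorem htsub_binder_of_condI {ι : Type*} [DecidableEq ι] (t : Finset ι → ℝ) {κ₁ : ℝ} (hκ₁ : 0 ≤ κ₁)
    {Nsz Rmax : ℕ} (SK : Finset ι → Finset (Pt n)) (Rt : Finset ι → ℕ)
    (ht : ∀ T, t T = κ₁ * treeLen (fineCubes (Rt T) (SK T)))
    (hRt : ∀ T, 0 < Rt T ∧ Rt T ≤ Rmax) (hne : ∀ T, (SK T).Nonempty) (hfc : ∀ T, FaceConnected (SK T))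
    (hI : ∀ T, CondI Nsz (SK T)) (S : Finset ι) (Conn : Finset ι → Prop) :
    ∀ T x, T ⊆ S → x ∈ T → 2 ≤ T.card → Conn T → Conn (T.erase x) →
      t T ≤ t {x} + t (T.erase x) + κ₁ * (((Nsz : ℝ) * Rmax) ^ n - 1) :=
  fun T x _ _ _ _ _ => htsub_of_condI t hκ₁ SK Rt ht hRt hne hfc hI T x

/-! ## §8. From the inductive statement (1.80) for every component of `Z_k` -/

/-- **FROM (1.80) FOR EVERY COMPONENT OF `Z_k`** (`Step.Budget.ScaleData.Invariant`, the currency of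
`B16Lem384Induction.invariant_all_ofIndex` ∕ `B16Improved189FullBudget.invariant_all_of_invariantT`): for a component
`Z` with horizon `K(Z) ≥ 1`, budget `κ_k(Z)` and profile whose entry at `k+1` is `d′_{k+1}(S(X)) = treeLen (Sop q X₀)` in
the index model, the factor form `𝐓 ≤ exp(−κ_k(Z) − P)` gives the improved bound with the additional term `−κ₁d_k(X)` —
§4 with `hctl := hinv Z`. [cite: Balaban1989LargeFieldII, p.387 ll.25–29, (1.80) p.384] -/
theorem improved189_arbitrary_of_invariant {V : Type*} (T1X : V → ℝ) (b : Step.Budget.Consts) {k : ℕ}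
    (D : Step.Budget.ScaleData k) (hinv : D.Invariant b) (Z : D.Comp) (hK : 1 ≤ D.K Z)
    (P a p κ₁ L : ℝ) {R q : ℕ} (hR : 0 < R) (hq : 0 < q)
    {X₀ : Finset (Pt n)} (hX : X₀.Nonempty) (hXc : FaceConnected X₀)
    (hT : ∀ v, T1X v ≤ Real.exp (-(D.κ Z) - P))
    (hC : 0 ≤ b.C) (hM : 0 ≤ b.M) (hRm : ∀ m, 0 ≤ b.R m) (hs : ∀ m, 0 ≤ D.size Z m)
    (hsize : D.size Z (k + 1) = treeLen (Sop q X₀))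
    (hdim : b.d = n) (hRq : ((R * q : ℕ) : ℝ) = L * b.R (k + 1))
    (hκ₁ : 0 ≤ κ₁) (hL : 0 ≤ L)
    (hslope : κ₁ * (4 * 2 ^ n) * L ^ b.d ≤ b.C * b.M ^ b.d * b.R (k + 1))
    (hP : 2 * a * p ≤ P)
    (hdef : κ₁ * ((4 * 2 ^ n) * (L * b.R (k + 1)) ^ b.d) ≤ a * p) :
    ∀ v, T1X v ≤ Real.exp (-(a * p) - κ₁ * treeLen (fineCubes R X₀)) :=
  improved189_arbitrary_ofIndex T1X b k (D.K Z) hK (D.κ Z) P a p κ₁ L (D.size Z) hR hq hX hXc hT (hinv Z) hC hM hRm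
    hs hsize hdim hRq hκ₁ hL hslope hP hdef

/-! ## §9 (v1.1, append-only). §4 read from the index-model PROFILE of `B16Lem384Induction` — the profile entry
`s_{k+1} = d′_{k+1}(S(X))` and the two-lattice dictionary `R_k·q_k = L·R_{k+1}` DERIVED from the flow's exponents

`B16Lem384Induction.invariant_base_ofIndex` ∕ `invariant_all_ofIndex` carry the size profile of a component `Z` born or
continued along one flow of [III] §2 as `size Z = fun n => treeLen (Siter (ratio L σ) (n − k) (reg Z))` (`σ_i = log_L R_{k+i}`,
`R_n = L^{σ_n}` by the minimality in (2.5), `B16SProfile.exists_exponents`); its entry at `n = k+1` is `treeLen (Sop (ratio L σ 0)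
(reg Z))`, and the first ratio `q_k = L^{σ₁+1−σ₀}` satisfies `R_k·q_k = L·R_{k+1}` as soon as `σ₀ ≤ σ₁ + 1` ((2.9) first
member; `B16SProfile.DropCtl.lag_one`).  So §4's `hsize` and `hRq` are theorems in that currency. -/

section Profile

open Literature.MathematicalPhysics.QuantumFieldTheory.Balaban1983to89.B16SProfile (Siter ratio Siter_succ Siter_zero ratio_pos)

/-- THE PROFILE ENTRY AT `k+1`: along any ratio sequence, `d′_{k+1}(S^{(k+1)−k}(X)) = d′_{k+1}(S(X))` with the first ratio —
`treeLen (Siter (ratio L σ) ((k+1) − k) X₀) = treeLen (Sop (ratio L σ 0) X₀)`. [cite: Balaban1989LargeFieldII, p.384 (definition of S; (1.80))] -/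
theorem profile_entry_succ (L : ℕ) (σ : ℕ → ℕ) (k : ℕ) (X₀ : Finset (Pt n)) :
    (fun m => treeLen (Siter (ratio L σ) (m - k) X₀)) (k + 1) = treeLen (Sop (ratio L σ 0) X₀) := by
  have h : k + 1 - k = 0 + 1 := by omega
  show treeLen (Siter (ratio L σ) (k + 1 - k) X₀) = _
  rw [h, Siter_succ, Siter_zero]

/-- THE TWO-LATTICE DICTIONARY FROM THE FLOW'S EXPONENTS: with `R_k = L^{σ₀}`, `R_{k+1} = L^{σ₁}` ((2.5): the `R`'s are
powers of `L`) and `σ₀ ≤ σ₁ + 1` ((2.9), first member: `R_{k+1} ≥ R_k∕L`), the first ratio `q_k = ratio L σ 0 = L^{σ₁+1−σ₀}`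
satisfies `R_k·q_k = L·R_{k+1}` — the number of M-cubes per LMR_{k+1}-cube side counted on either lattice. [cite: Balaban1988Convergent, (2.5) p.255, (2.9) p.256] -/
theorem dictionary_of_exponents (L : ℕ) (σ : ℕ → ℕ) (Rk Rk1 : ℕ) (hRk : Rk = L ^ σ 0) (hRk1 : Rk1 = L ^ σ 1)
    (hlag : σ 0 ≤ σ 1 + 1) : Rk * ratio L σ 0 = L * Rk1 := by
  subst hRk hRk1
  have hq : ratio L σ 0 = L ^ (σ 1 + 1 - σ 0) := rfl
  rw [hq, ← pow_add, show σ 0 + (σ 1 + 1 - σ 0) = σ 1 + 1 by omega, pow_succ, mul_comm]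

/-- **THE IMPROVED BOUND FOR AN ARBITRARY REGION, READ FROM THE INDEX-MODEL PROFILE** (`B16Lem384Induction` §8–§9 currency):
§4's `improved189_arbitrary_ofIndex` with the profile entry `s_{k+1} = treeLen (Sop q_k X₀)` and the dictionary
`R_k·q_k = L·R_{k+1}` DERIVED (`profile_entry_succ`, `dictionary_of_exponents`) from a profile of the form
`s = fun n => treeLen (Siter (ratio L σ) (n − k) X₀)` and the exponents `R_k = L^{σ₀}`, `R_{k+1} = L^{σ₁}`, `σ₀ ≤ σ₁ + 1`,
`b.R (k+1) = R_{k+1}`; the non-negativity of the profile is automatic (`treeLen ≥ 0`).  Remaining inputs: the factor form,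
(1.80) `Controls b k K κ s` with `K ≥ 1`, `2ap ≤ P`, `b.d = d`, and the located clauses `hslope`, `hdef`.
[cite: Balaban1989LargeFieldII, p.387 ll.25–29, (1.80) p.384; Balaban1988Convergent, (2.5) p.255, (2.9) p.256] -/
theorem improved189_arbitrary_ofIndexProfile {V : Type*} (T1X : V → ℝ) (b : Step.Budget.Consts) (k K : ℕ) (hK : 1 ≤ K)
    (κ P a p κ₁ : ℝ) {L : ℕ} (hL : 0 < L) (σ : ℕ → ℕ) (Rnat : ℕ → ℕ)
    (hRk : Rnat k = L ^ σ 0) (hRk1 : Rnat (k + 1) = L ^ σ 1) (hlag : σ 0 ≤ σ 1 + 1)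
    (hbR : b.R (k + 1) = (Rnat (k + 1) : ℝ))
    {X₀ : Finset (Pt n)} (hX : X₀.Nonempty) (hXc : FaceConnected X₀)
    (hT : ∀ v, T1X v ≤ Real.exp (-κ - P))
    {s : ℕ → ℝ} (hctl : Step.Budget.Controls b k K κ s) (hC : 0 ≤ b.C) (hM : 0 ≤ b.M) (hRm : ∀ m, 0 ≤ b.R m)
    (hsize : s = fun m => treeLen (Siter (ratio L σ) (m - k) X₀))
    (hdim : b.d = n) (hκ₁ : 0 ≤ κ₁)
    (hslope : κ₁ * (4 * 2 ^ n) * (L : ℝ) ^ b.d ≤ b.C * b.M ^ b.d * b.R (k + 1))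
    (hP : 2 * a * p ≤ P)
    (hdef : κ₁ * ((4 * 2 ^ n) * ((L : ℝ) * b.R (k + 1)) ^ b.d) ≤ a * p) :
    ∀ v, T1X v ≤ Real.exp (-(a * p) - κ₁ * treeLen (fineCubes (Rnat k) X₀)) := by
  have hs : ∀ m, 0 ≤ s m := fun m => by
    rw [hsize]
    exact treeLen_nonneg _
  have hsize' : s (k + 1) = treeLen (Sop (ratio L σ 0) X₀) := by
    rw [hsize]
    exact profile_entry_succ L σ k X₀
  have hR : 0 < Rnat k := by
    rw [hRk]
    exact Nat.pow_pos hL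
  have hRq : ((Rnat k * ratio L σ 0 : ℕ) : ℝ) = (L : ℝ) * b.R (k + 1) := by
    rw [dictionary_of_exponents L σ (Rnat k) (Rnat (k + 1)) hRk hRk1 hlag, Nat.cast_mul, hbR]
  exact improved189_arbitrary_ofIndex T1X b k K hK κ P a p κ₁ (L : ℝ) s hR (ratio_pos hL σ 0) hX hXc hT hctl hC hM hRm
    hs hsize' hdim hRq hκ₁ (Nat.cast_nonneg _) hslope hP hdef

end Profile

end

end Literature.MathematicalPhysics.QuantumFieldTheory.Balaban1983to89.B16Improved189ArbitraryRegion
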